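import Summits.QuantumFields.BalabanUV.Beta.MultiscaleRemainderLeibniz
import Summits.QuantumFields.BalabanUV.Beta.CovariantTowerRemainder

/-!
# Beta / MultiscaleRemainderLapTorus — THE WEIGHTED LATTICE LAPLACIAN `Δ_c h` ON THE TORUS FOR A CONSTANT BOND WEIGHT IS THE SUM
# OF THE CENTRED SECOND DIFFERENCES, AND THE b05 SMOOTH PARTITION SUPPLIES THE SCALE-ADAPTED BUMP DATA OF ONE LAYER (MODEL)

Node (w4-b′) (`MultiscaleParametrixTorus.remainder_le_torus_adapted`) consumes two bump data: `|c(b)(∂h)(b)| ≤ c_maxC₁/(M n_z)`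
and `|(Δ_c h)(x)| ≤ c_max²C₂/(M n_z)²`, `Δ_c h = lapH` of `MultiscaleRemainderLeibniz` (a general bond weight `c`).  Print's weight
is constant (`c ≡ η⁻¹`); this module records, for the torus `UT N` with its nearest-neighbour bonds (`bsrc (y, μ) = y`,
`btgt (y, μ) = y + e_μ`):
* **`lapH_torus_const`**: for `c ≡ c₀`, `(Δ_c h)(x) = c₀²·Σ_μ (h(x + e_μ) − 2h(x) + h(x − e_μ))` (the bonds INTO `x` along `μ` are
  exactly `(x − e_μ, μ)`, b05 `up_dn`/`up_injective`); **`abs_lapH_torus_const_le`**: `|Δ_c h(x)| ≤ c₀²·d·δ₂` whenever every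
  centred second difference of `h` is `≤ δ₂`;
* **`hSU_bump_data`**: for the b05 partition function `h = hSU N M₀ z` ([B5] (1.118)) at scale `M₀ = M·n` and `c ≡ c₀`:
  `|c∂h| ≤ |c₀|·4d/(M·n)` (b05 `hSU_lipschitz`), `|Δ_c h| ≤ c₀²·52d/(M·n)²` (b05 `abs_hSU_centred_le`), `|h| ≤ 1`,
  `supp h ⊆ ball(ctrU z, M₀)` (`hSU_eq_zero_of_far`) — i.e. the data `C₁ = 4d`, `C₂ = 52d` of ONE LAYER's cube factor in the
  product design `h_{(j,z)} = ψ_j·hSU^{(M S_j)}_z` of (w4-a′) (O.2 skeleton v1.5.0 §8.10); the product rules of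
  `MultiscalePartitionProduct` then combine them with the layer factor's data
(unit `b2b-balaban-beta-d4-p2`, GEN 9, MODEL crew).

HONEST FRAMING: discharging `BetaPertH` makes Bałaban's UV stability UNCONDITIONAL — NOT the continuum limit, NOT the
Clay problem.  HONEST DEPENDENCY (verbatim): «continuum YM on T⁴ ⇐ BetaPertH ∧ nine spine estimates (0/9 proved);
BetaPertH ⇐ (D1) ∧ (D4) ∧ CAP+tail; G-an2-4 gates asym, D1 and NE2/3/4.»  THIS MODULE DISCHARGES NOTHING of `BetaPertH`,
asserts NOTHING printed and cites nothing as a fact (ABSOLUTE RULE): [folklore] bookkeeping on the torus MODEL; b05's kernel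
theorems BY NAME.  LOCI (shape only): [B9] = `Balaban1985BackgroundPropagators` (3.88) p. 409 (the `Δh` coefficient of K(h));
[B5] = `Balaban1984PropagatorsI` (1.118), (1.121) p. 37; [B6] = `Balaban1984PropagatorsII` (2.36), (2.40) pp. 229–230.  No class
change on row D4 (critical-path width 0; D4 DISCHARGE NO DATE); NOT BetaPertH, NOT continuum, NOT Clay, NOT summit progress.
-/

namespace Summit.QuantumFields.BalabanUV.Beta.MultiscaleRemainderLapTorus

open Finset
open Literature.MathematicalPhysics.QuantumFieldTheory.Balaban1983to89
open Literature.MathematicalPhysics.QuantumFieldTheory.Balaban1983to89.B9Thm37GluePU (bsrc btgt bsrc_apply btgt_apply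
  hSU_eq_zero_of_far hh_torus)
open Literature.MathematicalPhysics.QuantumFieldTheory.Balaban1983to89.B9Thm37GlueTorusCovCT (up_injective)
open B5TorusCover (UT Ctr ctrU)
open B5SmoothPartition (hSU hSU_lipschitz)
open B5Leibniz121 (up dn up_dn dist_up_le abs_hSU_centred_le)
open Summit.QuantumFields.BalabanUV.Beta.MultiscaleRemainderLeibniz

noncomputable section

variable {d : ℕ} {N : Fin d → ℕ} [∀ i, NeZero (N i)]

/-! ## §1  `Δ_c h` on the torus for a constant bond weight -/

omit [∀ i, NeZero (N i)] in
/-- The bonds OUT of `x`: `Σ_b [bsrc b = x]·F(b) = Σ_μ F(x, μ)`. [folklore] -/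
theorem sum_ite_bsrc_eq (x : UT N) (F : UT N × Fin d → ℝ) :
    ∑ b : UT N × Fin d, (if bsrc b = x then F b else 0) = ∑ μ, F (x, μ) := by
  classical
  rw [Fintype.sum_prod_type, Finset.sum_comm]
  refine Finset.sum_congr rfl fun μ _ => ?_
  rw [Finset.sum_eq_single x]
  · simp
  · intro y _ hy
    rw [if_neg]
    simpa using hy
  · intro hx
    exact absurd (Finset.mem_univ _) hx

/-- The bonds INTO `x`: `Σ_b [btgt b = x]·F(b) = Σ_μ F(x − e_μ, μ)` (the bond into `x` along `μ` starts at `x − e_μ`; b05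
`up_dn`, `up_injective`). [folklore] -/
theorem sum_ite_btgt_eq (x : UT N) (F : UT N × Fin d → ℝ) :
    ∑ b : UT N × Fin d, (if btgt b = x then F b else 0) = ∑ μ, F (dn x μ, μ) := by
  classical
  rw [Fintype.sum_prod_type, Finset.sum_comm]
  refine Finset.sum_congr rfl fun μ _ => ?_
  rw [Finset.sum_eq_single (dn x μ)]
  · simp [up_dn x μ]
  · intro y _ hy
    rw [if_neg]
    rw [btgt_apply]
    intro h
    apply hy
    have h2 : up y μ = up (dn x μ) μ := by rw [h, up_dn]
    exact up_injective μ h2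
  · intro hx
    exact absurd (Finset.mem_univ _) hx

/-- **`Δ_c h` for a constant bond weight is `c₀²` times the sum of the centred second differences**:
`(Δ_c h)(x) = c₀²·Σ_μ (h(x + e_μ) − 2h(x) + h(x − e_μ))`. [cite: Balaban1985BackgroundPropagators, (3.88) p.409] -/
theorem lapH_torus_const {c : UT N × Fin d → ℝ} {c₀ : ℝ} (hc : ∀ b, c b = c₀) (h : UT N → ℝ) (x : UT N) :
    lapH bsrc btgt c h x = c₀ ^ 2 * ∑ μ, (h (up x μ) - 2 * h x + h (dn x μ)) := by
  unfold lapH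
  rw [Finset.sum_sub_distrib, sum_ite_bsrc_eq, sum_ite_btgt_eq, Finset.mul_sum, ← Finset.sum_sub_distrib]
  refine Finset.sum_congr rfl fun μ _ => ?_
  simp only [bsrc_apply, btgt_apply, hc, up_dn]
  ring

/-- **`|Δ_c h(x)| ≤ c₀²·d·δ₂`** when every centred second difference of `h` at `x` is `≤ δ₂`. [folklore] -/
theorem abs_lapH_torus_const_le {c : UT N × Fin d → ℝ} {c₀ : ℝ} (hc : ∀ b, c b = c₀) (h : UT N → ℝ) (x : UT N) {δ₂ : ℝ}
    (hδ : ∀ μ, |h (up x μ) - 2 * h x + h (dn x μ)| ≤ δ₂) : |lapH bsrc btgt c h x| ≤ c₀ ^ 2 * (d * δ₂) := by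
  rw [lapH_torus_const hc h x, abs_mul, abs_of_nonneg (sq_nonneg c₀)]
  refine mul_le_mul_of_nonneg_left ?_ (sq_nonneg c₀)
  calc |∑ μ, (h (up x μ) - 2 * h x + h (dn x μ))| ≤ ∑ μ, |h (up x μ) - 2 * h x + h (dn x μ)| := abs_sum_le_sum_abs _ _
    _ ≤ ∑ _μ : Fin d, δ₂ := Finset.sum_le_sum fun μ _ => hδ μ
    _ = d * δ₂ := by rw [Finset.sum_const, Finset.card_univ, Fintype.card_fin, nsmul_eq_mul]

/-- First differences along a bond with a constant weight: `|c(b)(h(b₊) − h(b₋))| = |c₀|·|h(y + e_μ) − h(y)|`. [folklore] -/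
theorem abs_cdh_eq {c : UT N × Fin d → ℝ} {c₀ : ℝ} (hc : ∀ b, c b = c₀) (h : UT N → ℝ) (b : UT N × Fin d) :
    |c b * (h (btgt b) - h (bsrc b))| = |c₀| * |h (up b.1 b.2) - h b.1| := by
  obtain ⟨y, μ⟩ := b
  rw [hc, abs_mul, btgt_apply, bsrc_apply]

/-! ## §2  The b05 partition function as one layer's cube factor -/

/-- **THE b05 BUMP AT SCALE `M₀ = M·n` CARRIES SCALE-ADAPTED DATA (MODEL).**  For `h = hSU N M₀ z` ([B5] (1.118)) on a torus with
`2M₀ ≤ N_i`, a constant bond weight `c ≡ c₀` and `M₀ = M·n` (`M, n ≥ 1`):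
`|c∂h| ≤ |c₀|·4d/(M·n)` on every bond, `|Δ_c h| ≤ c₀²·(52d)/(M·n)²` at every site, `|h| ≤ 1`, and `h(x) = 0` whenever
`dist(x, ctrU z) ≥ M₀` — the data `C₁ = 4d`, `C₂ = 52d` (with `c_max = |c₀|`) and the support clause of one layer's cube factor
in the product design of (w4-a′). [cite: Balaban1984PropagatorsI, (1.118) p.37 + (1.121) p.37; Balaban1984PropagatorsII, (2.36) p.229] -/
theorem hSU_bump_data {c : UT N × Fin d → ℝ} {c₀ : ℝ} (hc : ∀ b, c b = c₀) {M n : ℕ} (hM : 1 ≤ M) (hn : 1 ≤ n)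
    (h2N : ∀ i, 2 * (M * n) ≤ N i) (z : Ctr N (M * n)) :
    (∀ b : UT N × Fin d, |c b * (hSU N (M * n) z (btgt b) - hSU N (M * n) z (bsrc b))| ≤ |c₀| * (4 * d) / ((M : ℝ) * n)) ∧
      (∀ x : UT N, |lapH bsrc btgt c (hSU N (M * n) z) x| ≤ |c₀| ^ 2 * (52 * d) / ((M : ℝ) * n) ^ 2) ∧
      (∀ x : UT N, |hSU N (M * n) z x| ≤ 1) ∧
      (∀ x : UT N, ((M * n : ℕ) : ℝ) ≤ dist x (ctrU N (M * n) z) → hSU N (M * n) z x = 0) := by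
  have hMn : 1 ≤ M * n := Nat.one_le_iff_ne_zero.mpr (Nat.mul_ne_zero (by omega) (by omega))
  have hMnR : ((M * n : ℕ) : ℝ) = (M : ℝ) * n := by push_cast; ring
  refine ⟨fun b => ?_, fun x => ?_, fun x => hh_torus (M * n) z x, fun x hx => hSU_eq_zero_of_far hMn hx⟩
  · rw [abs_cdh_eq hc]
    have hl := hSU_lipschitz N hMn z (up b.1 b.2) b.1
    have hd1 : dist (up b.1 b.2) b.1 ≤ 1 := by rw [dist_comm]; exact dist_up_le b.1 b.2
    have h4 : (0 : ℝ) ≤ 4 * d / (M * n : ℕ) := by positivity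
    calc |c₀| * |hSU N (M * n) z (up b.1 b.2) - hSU N (M * n) z b.1| ≤ |c₀| * (4 * d / (M * n : ℕ) * dist (up b.1 b.2) b.1) :=
          mul_le_mul_of_nonneg_left hl (abs_nonneg _)
      _ ≤ |c₀| * (4 * d / (M * n : ℕ) * 1) :=
          mul_le_mul_of_nonneg_left (mul_le_mul_of_nonneg_left hd1 h4) (abs_nonneg _)
      _ = |c₀| * (4 * d) / ((M : ℝ) * n) := by rw [hMnR]; ring
  · have h2 := abs_lapH_torus_const_le hc (hSU N (M * n) z) x (fun μ => abs_hSU_centred_le hMn h2N z x μ)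
    calc |lapH bsrc btgt c (hSU N (M * n) z) x| ≤ c₀ ^ 2 * (d * (52 / ((M * n : ℕ) : ℝ) ^ 2)) := h2
      _ = |c₀| ^ 2 * (52 * d) / ((M : ℝ) * n) ^ 2 := by rw [sq_abs, hMnR]; ring

end

end Summit.QuantumFields.BalabanUV.Beta.MultiscaleRemainderLapTorus
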